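import Mathlib.MeasureTheory.Integral.Layercake
import Mathlib.MeasureTheory.Measure.Lebesgue.EqHaar
import Mathlib.MeasureTheory.Measure.Haar.InnerProductSpace
import Mathlib.MeasureTheory.Constructions.Pi
import Mathlib.Analysis.MeanInequalities
import Mathlib.Analysis.SpecialFunctions.Pow.Continuity
import HarnessLib

/-!
# The Prékopa–Leindler inequality (with the one-dimensional Brunn–Minkowski inequality)

Topic `Literature/Analysis/Convexity`. Fully proved (no named facts).

**Prékopa–Leindler.** For `0 < s < 1` and measurable `f, g, h : ℝⁿ → [0, ∞]` with
`h((1-s)x + sy) ≥ f(x)^{1-s} g(y)^s` for all `x, y`:  `∫ h ≥ (∫ f)^{1-s} (∫ g)^s`.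
This is the classical (`sup`) form; Brascamp–Lieb 1976 (J. Funct. Anal. 22, 366–389), Theorems 3.1–3.3,
prove the stronger `ess sup` form (their case `α = 0`), which implies this one. We follow their proof:

* `volume_add_volume_le_volume_add` — Brunn–Minkowski on the line, `vol(A + B) ≥ vol A + vol B` for
  nonempty measurable `A, B ⊆ ℝ` (compact case by the `max A + B ∪ A + min B` trick, then inner regularity);
* `lintegral_add_lintegral_le_of_iSup_eq_one` — BL76 Thm 3.1: superlevel sets
  `{h > t} ⊇ (1-s){f > t} + s{g > t}`, layer-cake formula and Brunn–Minkowski give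
  `∫ h ≥ (1-s)∫ f + s∫ g` when `sup f = sup g = 1`;
* `prekopaLeindler_real` — BL76 Thm 3.2 (`α = 0`): normalise by the suprema, weighted AM–GM, and a
  truncation `min f N ↑ f` to allow unbounded / non-integrable data;
* `prekopaLeindler_pi` — BL76 Thm 3.3: induction on the dimension on `Fin n → ℝ` (split off the
  first coordinate with `MeasurableEquiv.piFinSuccAbove`, Tonelli, induction hypothesis on the sections,
  the one-dimensional case on the partial integrals);
* `prekopaLeindler`, `prekopaLeindler_integral` — transfer to `EuclideanSpace ℝ (Fin n)` (the
  identification with `Fin n → ℝ` is linear and volume preserving) and a real-valued (Bochner) form.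

Everything is stated for Lebesgue measure `volume`. Not here: the `ess sup` strengthening, the general
means `hₐ` (`α ≠ 0`) of BL76 §3, Brunn–Minkowski in `ℝⁿ`, equality cases.
-/

noncomputable section

open MeasureTheory Set Filter Topology
open scoped ENNReal NNReal Pointwise

namespace Literature.Analysis.Convexity

/-! ### One-dimensional Brunn–Minkowski -/

/-- Brunn–Minkowski on the line for nonempty compact sets: `vol K + vol L ≤ vol (K + L)`.
Proof: `K + L ⊇ (K + min L) ∪ (max K + L)` and the two pieces meet only in `max K + min L`.
(Cf. Brascamp–Lieb 1976, eq. (1.1) with `n = 1`.) [folklore] -/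
theorem volume_add_volume_le_volume_add_of_isCompact {K L : Set ℝ} (hK : IsCompact K)
    (hL : IsCompact L) (hKne : K.Nonempty) (hLne : L.Nonempty) :
    volume K + volume L ≤ volume (K + L) := by
  set a := sSup K with ha_def
  set b := sInf L with hb_def
  have ha : a ∈ K := hK.sSup_mem hKne
  have hb : b ∈ L := hL.sInf_mem hLne
  have hS : volume (b +ᵥ K) = volume K := measure_vadd volume b K
  have hT : volume (a +ᵥ L) = volume L := measure_vadd volume a L
  have hTm : MeasurableSet (a +ᵥ L) := (hL.vadd a).measurableSet
  have hsub : (b +ᵥ K) ∪ (a +ᵥ L) ⊆ K + L := by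
    rintro x (hx | hx)
    · obtain ⟨k, hk, rfl⟩ := Set.mem_vadd_set.1 hx
      rw [vadd_eq_add, show b + k = k + b from add_comm b k]
      exact Set.add_mem_add hk hb
    · obtain ⟨l, hl, rfl⟩ := Set.mem_vadd_set.1 hx
      exact Set.add_mem_add ha hl
  have hinter : (b +ᵥ K) ∩ (a +ᵥ L) ⊆ {a + b} := by
    rintro x ⟨hx1, hx2⟩
    obtain ⟨k, hk, rfl⟩ := Set.mem_vadd_set.1 hx1
    obtain ⟨l, hl, hkl⟩ := Set.mem_vadd_set.1 hx2
    simp only [vadd_eq_add] at hkl ⊢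
    have hk' : k ≤ a := le_csSup hK.bddAbove hk
    have hl' : b ≤ l := csInf_le hL.bddBelow hl
    rw [Set.mem_singleton_iff]
    linarith
  calc volume K + volume L = volume (b +ᵥ K) + volume (a +ᵥ L) := by rw [hS, hT]
    _ = volume ((b +ᵥ K) ∪ (a +ᵥ L)) + volume ((b +ᵥ K) ∩ (a +ᵥ L)) :=
        (measure_union_add_inter _ hTm).symm
    _ ≤ volume (K + L) + volume ({a + b} : Set ℝ) :=
        add_le_add (measure_mono hsub) (measure_mono hinter)
    _ = volume (K + L) := by simp

/-- **Brunn–Minkowski on the line**: for nonempty measurable `A, B ⊆ ℝ`,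
`vol A + vol B ≤ vol (A + B)` (outer Lebesgue measure on the right).
(Brascamp–Lieb 1976, eq. (1.1), `n = 1`.) [folklore] -/
theorem volume_add_volume_le_volume_add {A B : Set ℝ} (hA : MeasurableSet A)
    (hB : MeasurableSet B) (hAne : A.Nonempty) (hBne : B.Nonempty) :
    volume A + volume B ≤ volume (A + B) := by
  obtain ⟨a₀, ha₀⟩ := hAne
  obtain ⟨b₀, hb₀⟩ := hBne
  -- degenerate cases
  by_cases hA0 : volume A = 0
  · rw [hA0, zero_add]
    calc volume B = volume (a₀ +ᵥ B) := (measure_vadd volume a₀ B).symm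
      _ ≤ volume (A + B) := measure_mono (by
          rintro x hx
          obtain ⟨y, hy, rfl⟩ := Set.mem_vadd_set.1 hx
          exact Set.add_mem_add ha₀ hy)
  by_cases hB0 : volume B = 0
  · rw [hB0, add_zero]
    calc volume A = volume (b₀ +ᵥ A) := (measure_vadd volume b₀ A).symm
      _ ≤ volume (A + B) := measure_mono (by
          rintro x hx
          obtain ⟨y, hy, rfl⟩ := Set.mem_vadd_set.1 hx
          rw [vadd_eq_add, show b₀ + y = y + b₀ from add_comm b₀ y]
          exact Set.add_mem_add hy hb₀)
  refine le_of_forall_lt fun c hc => ?_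
  obtain ⟨a', ha', b', hb', hc'⟩ := ENNReal.exists_lt_add_of_lt_add hc hA0 hB0
  obtain ⟨K, hKA, hK, haK⟩ := hA.exists_lt_isCompact ha'
  obtain ⟨L, hLB, hL, hbL⟩ := hB.exists_lt_isCompact hb'
  have hKne : K.Nonempty := by
    by_contra h
    rw [Set.not_nonempty_iff_eq_empty] at h
    simp [h] at haK
  have hLne : L.Nonempty := by
    by_contra h
    rw [Set.not_nonempty_iff_eq_empty] at h
    simp [h] at hbL
  calc c < a' + b' := hc'
    _ ≤ volume K + volume L := add_le_add haK.le hbL.le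
    _ ≤ volume (K + L) := volume_add_volume_le_volume_add_of_isCompact hK hL hKne hLne
    _ ≤ volume (A + B) := measure_mono (Set.add_subset_add hKA hLB)

/-- Scaled Brunn–Minkowski on the line: for nonempty measurable `A, B ⊆ ℝ` and `a, b > 0`,
`a·vol A + b·vol B ≤ vol (a•A + b•B)`. [folklore] -/
theorem smul_volume_add_smul_volume_le {A B : Set ℝ} (hA : MeasurableSet A)
    (hB : MeasurableSet B) (hAne : A.Nonempty) (hBne : B.Nonempty) {a b : ℝ} (ha : 0 < a)
    (hb : 0 < b) :
    ENNReal.ofReal a * volume A + ENNReal.ofReal b * volume B ≤ volume (a • A + b • B) := by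
  have hA' : volume (a • A) = ENNReal.ofReal a * volume A := by
    rw [Measure.addHaar_smul_of_nonneg volume ha.le, Module.finrank_self, pow_one]
  have hB' : volume (b • B) = ENNReal.ofReal b * volume B := by
    rw [Measure.addHaar_smul_of_nonneg volume hb.le, Module.finrank_self, pow_one]
  rw [← hA', ← hB']
  exact volume_add_volume_le_volume_add (hA.const_smul₀ a) (hB.const_smul₀ b)
    (hAne.smul_set) (hBne.smul_set)

/-! ### Prékopa–Leindler on the line (Brascamp–Lieb 1976, Theorems 3.1–3.2) -/

/-- Weighted AM–GM in `ℝ≥0∞`: `a^{1-s} b^s ≤ (1-s) a + s b`. [folklore] -/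
theorem rpow_mul_rpow_le_add {s : ℝ} (hs0 : 0 < s) (hs1 : s < 1) (a b : ℝ≥0∞) :
    a ^ (1 - s) * b ^ s ≤ ENNReal.ofReal (1 - s) * a + ENNReal.ofReal s * b := by
  have h1s : 0 < 1 - s := by linarith
  rcases eq_or_ne a ⊤ with rfl | ha
  · have : ENNReal.ofReal (1 - s) * ⊤ = ⊤ := ENNReal.mul_top (by simpa using h1s)
    rw [this, top_add]
    exact le_top
  rcases eq_or_ne b ⊤ with rfl | hb
  · have : ENNReal.ofReal s * ⊤ = ⊤ := ENNReal.mul_top (by simpa using hs0)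
    rw [this, add_top]
    exact le_top
  lift a to ℝ≥0 using ha
  lift b to ℝ≥0 using hb
  have key := Real.geom_mean_le_arith_mean2_weighted h1s.le hs0.le a.coe_nonneg b.coe_nonneg
    (by ring : (1 - s) + s = 1)
  rw [← ENNReal.coe_rpow_of_nonneg _ h1s.le, ← ENNReal.coe_rpow_of_nonneg _ hs0.le,
    ENNReal.ofReal, ENNReal.ofReal, ← ENNReal.coe_mul, ← ENNReal.coe_mul, ← ENNReal.coe_mul,
    ← ENNReal.coe_add, ENNReal.coe_le_coe, ← NNReal.coe_le_coe]
  push_cast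
  rw [Real.coe_toNNReal _ h1s.le, Real.coe_toNNReal _ hs0.le]
  exact key

/-- Superlevel sets of a Prékopa–Leindler triple: `(1-s){f > t} + s{g > t} ⊆ {h > t}`
(Brascamp–Lieb 1976, proof of Thm 3.1). [cite: BrascampLieb1976, Thm 3.1] -/
theorem smul_setOf_lt_add_smul_setOf_lt_subset {α : Type*} [AddCommGroup α] [Module ℝ α]
    {s : ℝ} (hs0 : 0 < s) (hs1 : s < 1) {f g h : α → ℝ≥0∞}
    (H : ∀ x y, f x ^ (1 - s) * g y ^ s ≤ h ((1 - s) • x + s • y)) (t : ℝ≥0∞) :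
    (1 - s) • {x | t < f x} + s • {y | t < g y} ⊆ {z | t < h z} := by
  rintro z hz
  obtain ⟨x', hx', y', hy', rfl⟩ := Set.mem_add.1 hz
  obtain ⟨x, hx, rfl⟩ := Set.mem_smul_set.1 hx'
  obtain ⟨y, hy, rfl⟩ := Set.mem_smul_set.1 hy'
  simp only [Set.mem_setOf_eq] at hx hy ⊢
  have httop : t ≠ ⊤ := hx.ne_top
  calc t = t ^ (1 - s) * t ^ s := by
        rcases eq_or_ne t 0 with rfl | ht0
        · simp [ENNReal.zero_rpow_of_pos hs0]
        rw [← ENNReal.rpow_add _ _ ht0 httop]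
        simp
    _ < f x ^ (1 - s) * g y ^ s :=
        ENNReal.mul_lt_mul (ENNReal.rpow_lt_rpow hx (by linarith)) (ENNReal.rpow_lt_rpow hy hs0)
    _ ≤ h ((1 - s) • x + s • y) := H x y

/-- `t ↦ vol{u > t}` is antitone. [folklore] -/
private theorem levelVol_antitone (u : ℝ → ℝ≥0∞) :
    Antitone (fun t : ℝ => volume {x | ENNReal.ofReal t < u x}) :=
  fun _ _ ht => measure_mono fun _ hx => lt_of_le_of_lt (ENNReal.ofReal_le_ofReal ht) hx

/-- `t ↦ vol{u > t}` is measurable (it is antitone). [folklore] -/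
private theorem levelVol_measurable (u : ℝ → ℝ≥0∞) :
    Measurable (fun t : ℝ => volume {x | ENNReal.ofReal t < u x}) :=
  (levelVol_antitone u).measurable

/-- Layer cake for a measurable `u ≤ 1`: `∫⁻ u = ∫_{(0,1)} vol{u > t} dt`. [folklore] -/
private theorem lintegral_eq_lintegral_levelVol {u : ℝ → ℝ≥0∞} (hu : Measurable u)
    (hu1 : ∀ x, u x ≤ 1) :
    ∫⁻ x, u x = ∫⁻ t in Ioo 0 1, volume {x | ENNReal.ofReal t < u x} := by
  have hne : ∀ x, u x ≠ ⊤ := fun x => ne_top_of_le_ne_top ENNReal.one_ne_top (hu1 x)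
  have h1 : ∫⁻ x, u x = ∫⁻ x, ENNReal.ofReal (u x).toReal := by
    congr 1
    ext x
    rw [ENNReal.ofReal_toReal (hne x)]
  rw [h1, lintegral_eq_lintegral_meas_lt volume (Eventually.of_forall fun x => ENNReal.toReal_nonneg)
    hu.ennreal_toReal.aemeasurable]
  have h2 : ∀ t ∈ Ioi (0:ℝ), volume {x | t < (u x).toReal} =
      (Iio 1).indicator (fun t : ℝ => volume {x | ENNReal.ofReal t < u x}) t := by
    intro t ht
    by_cases ht1 : t < 1
    · rw [indicator_of_mem (mem_Iio.2 ht1)]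
      congr 1
      ext x
      simp only [mem_setOf_eq]
      rw [ENNReal.ofReal_lt_iff_lt_toReal (le_of_lt ht) (hne x)]
    · rw [indicator_of_notMem (fun h => ht1 (mem_Iio.1 h))]
      have : {x | t < (u x).toReal} = ∅ := by
        ext x
        simp only [mem_setOf_eq, mem_empty_iff_false, iff_false, not_lt]
        calc (u x).toReal ≤ (1 : ℝ≥0∞).toReal := ENNReal.toReal_mono ENNReal.one_ne_top (hu1 x)
          _ = 1 := by simp
          _ ≤ t := not_lt.1 ht1
      rw [this, measure_empty]
  rw [setLIntegral_congr_fun measurableSet_Ioi h2, lintegral_indicator measurableSet_Iio,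
    Measure.restrict_restrict measurableSet_Iio, Iio_inter_Ioi]

/-- Core of the one-dimensional Prékopa–Leindler inequality (Brascamp–Lieb 1976, Thm 3.1, the
case `α = 0` with `sup` in place of `ess sup`): if `sup f = sup g = 1` then
`(1-s)∫f + s∫g ≤ ∫h`. [cite: BrascampLieb1976, Thm 3.1] -/
theorem lintegral_add_lintegral_le_of_iSup_eq_one {s : ℝ} (hs0 : 0 < s) (hs1 : s < 1)
    {f g h : ℝ → ℝ≥0∞} (hf : Measurable f) (hg : Measurable g) (hh : Measurable h)
    (H : ∀ x y, f x ^ (1 - s) * g y ^ s ≤ h ((1 - s) • x + s • y))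
    (hf1 : ⨆ x, f x = 1) (hg1 : ⨆ y, g y = 1) :
    ENNReal.ofReal (1 - s) * (∫⁻ x, f x) + ENNReal.ofReal s * (∫⁻ y, g y) ≤ ∫⁻ z, h z := by
  have hf_le : ∀ x, f x ≤ 1 := fun x => hf1 ▸ le_iSup f x
  have hg_le : ∀ y, g y ≤ 1 := fun y => hg1 ▸ le_iSup g y
  -- level-set volumes `Φ u t = vol{u > t}`
  set Φ : (ℝ → ℝ≥0∞) → ℝ → ℝ≥0∞ := fun u t => volume {x | ENNReal.ofReal t < u x} with hΦ_def
  -- the truncation `min h 1` is bounded by `1` and has the same superlevel sets below level `1`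
  have layer_h : ∫⁻ t in Ioo 0 1, Φ h t ≤ ∫⁻ z, h z := by
    set h₁ : ℝ → ℝ≥0∞ := fun z => min (h z) 1 with hh₁_def
    have hh₁ : Measurable h₁ := hh.min measurable_const
    have hh₁le : ∀ z, h₁ z ≤ 1 := fun z => min_le_right _ _
    calc ∫⁻ t in Ioo 0 1, Φ h t = ∫⁻ t in Ioo 0 1, Φ h₁ t := by
          refine setLIntegral_congr_fun measurableSet_Ioo (fun t ht => ?_)
          simp only [hΦ_def, hh₁_def]
          congr 1
          ext z
          simp only [mem_setOf_eq, lt_min_iff]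
          exact ⟨fun hz => ⟨hz, ENNReal.ofReal_lt_one.2 ht.2⟩, fun hz => hz.1⟩
      _ = ∫⁻ z, h₁ z := (lintegral_eq_lintegral_levelVol hh₁ hh₁le).symm
      _ ≤ ∫⁻ z, h z := lintegral_mono fun z => min_le_left _ _
  -- Brunn–Minkowski on each level `t ∈ (0,1)`
  have level : ∀ t ∈ Ioo (0:ℝ) 1,
      ENNReal.ofReal (1 - s) * Φ f t + ENNReal.ofReal s * Φ g t ≤ Φ h t := by
    intro t ht
    have ht' : ENNReal.ofReal t < 1 := ENNReal.ofReal_lt_one.2 ht.2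
    have hne_f : {x | ENNReal.ofReal t < f x}.Nonempty := by
      have : ENNReal.ofReal t < ⨆ x, f x := by rwa [hf1]
      obtain ⟨x, hx⟩ := lt_iSup_iff.1 this
      exact ⟨x, hx⟩
    have hne_g : {y | ENNReal.ofReal t < g y}.Nonempty := by
      have : ENNReal.ofReal t < ⨆ y, g y := by rwa [hg1]
      obtain ⟨y, hy⟩ := lt_iSup_iff.1 this
      exact ⟨y, hy⟩
    calc ENNReal.ofReal (1 - s) * Φ f t + ENNReal.ofReal s * Φ g t
        ≤ volume ((1 - s) • {x | ENNReal.ofReal t < f x} + s • {y | ENNReal.ofReal t < g y}) :=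
          smul_volume_add_smul_volume_le (measurableSet_lt measurable_const hf)
            (measurableSet_lt measurable_const hg) hne_f hne_g (by linarith) hs0
      _ ≤ Φ h t := measure_mono (smul_setOf_lt_add_smul_setOf_lt_subset hs0 hs1 H _)
  calc ENNReal.ofReal (1 - s) * (∫⁻ x, f x) + ENNReal.ofReal s * (∫⁻ y, g y)
      = ENNReal.ofReal (1 - s) * (∫⁻ t in Ioo 0 1, Φ f t) +
          ENNReal.ofReal s * (∫⁻ t in Ioo 0 1, Φ g t) := by
        rw [lintegral_eq_lintegral_levelVol hf hf_le, lintegral_eq_lintegral_levelVol hg hg_le]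
    _ = ∫⁻ t in Ioo 0 1, (ENNReal.ofReal (1 - s) * Φ f t + ENNReal.ofReal s * Φ g t) := by
        rw [lintegral_add_left ((levelVol_measurable f).const_mul _),
          lintegral_const_mul _ (levelVol_measurable f), lintegral_const_mul _ (levelVol_measurable g)]
    _ ≤ ∫⁻ t in Ioo 0 1, Φ h t := setLIntegral_mono' measurableSet_Ioo level
    _ ≤ ∫⁻ z, h z := layer_h

/-- One-dimensional Prékopa–Leindler for bounded `f, g` (Brascamp–Lieb 1976, Thm 3.2, `α = 0`,
bounded case: normalise by the suprema and use weighted AM–GM). [cite: BrascampLieb1976, Thm 3.2] -/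
theorem prekopaLeindler_real_of_bounded {s : ℝ} (hs0 : 0 < s) (hs1 : s < 1)
    {f g h : ℝ → ℝ≥0∞} (hf : Measurable f) (hg : Measurable g) (hh : Measurable h)
    (H : ∀ x y, f x ^ (1 - s) * g y ^ s ≤ h ((1 - s) • x + s • y))
    {C : ℝ≥0∞} (hC : C ≠ ⊤) (hfC : ∀ x, f x ≤ C) (hgC : ∀ y, g y ≤ C) :
    (∫⁻ x, f x) ^ (1 - s) * (∫⁻ y, g y) ^ s ≤ ∫⁻ z, h z := by
  have h1s : 0 < 1 - s := by linarith
  set A := ⨆ x, f x with hA_def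
  set B := ⨆ y, g y with hB_def
  have hAtop : A ≠ ⊤ := ne_top_of_le_ne_top hC (iSup_le hfC)
  have hBtop : B ≠ ⊤ := ne_top_of_le_ne_top hC (iSup_le hgC)
  rcases eq_or_ne A 0 with hA0 | hA0
  · have hf0 : ∀ x, f x = 0 := fun x => le_zero_iff.1 (hA0 ▸ le_iSup f x)
    simp [hf0, ENNReal.zero_rpow_of_pos h1s]
  rcases eq_or_ne B 0 with hB0 | hB0
  · have hg0 : ∀ y, g y = 0 := fun y => le_zero_iff.1 (hB0 ▸ le_iSup g y)
    simp [hg0, ENNReal.zero_rpow_of_pos hs0]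
  -- normalise
  set D := A ^ (1 - s) * B ^ s with hD_def
  have hA1 : A ^ (1 - s) ≠ 0 := by simp [ENNReal.rpow_eq_zero_iff, hA0, hAtop]
  have hA2 : A ^ (1 - s) ≠ ⊤ := by simp [ENNReal.rpow_eq_top_iff, hA0, hAtop]
  have hB1 : B ^ s ≠ 0 := by simp [ENNReal.rpow_eq_zero_iff, hB0, hBtop]
  have hB2 : B ^ s ≠ ⊤ := by simp [ENNReal.rpow_eq_top_iff, hB0, hBtop]
  have hD0 : D ≠ 0 := mul_ne_zero hA1 hB1
  have hDtop : D ≠ ⊤ := ENNReal.mul_ne_top hA2 hB2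
  have hDinv : (A ^ (1 - s))⁻¹ * (B ^ s)⁻¹ = D⁻¹ := (ENNReal.mul_inv (Or.inl hA1) (Or.inl hA2)).symm
  set F : ℝ → ℝ≥0∞ := fun x => f x * A⁻¹ with hF_def
  set G : ℝ → ℝ≥0∞ := fun y => g y * B⁻¹ with hG_def
  set K : ℝ → ℝ≥0∞ := fun z => h z * D⁻¹ with hK_def
  have hF1 : ⨆ x, F x = 1 := by
    rw [hF_def, ← ENNReal.iSup_mul, ENNReal.mul_inv_cancel hA0 hAtop]
  have hG1 : ⨆ y, G y = 1 := by
    rw [hG_def, ← ENNReal.iSup_mul, ENNReal.mul_inv_cancel hB0 hBtop]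
  have HK : ∀ x y, F x ^ (1 - s) * G y ^ s ≤ K ((1 - s) • x + s • y) := by
    intro x y
    simp only [hF_def, hG_def, hK_def]
    rw [ENNReal.mul_rpow_of_nonneg _ _ h1s.le, ENNReal.mul_rpow_of_nonneg _ _ hs0.le,
      mul_mul_mul_comm, ENNReal.inv_rpow, ENNReal.inv_rpow, hDinv]
    exact mul_le_mul' (H x y) le_rfl
  have core := lintegral_add_lintegral_le_of_iSup_eq_one hs0 hs1 (hf.mul_const _) (hg.mul_const _)
    (hh.mul_const _) HK hF1 hG1
  have amgm := rpow_mul_rpow_le_add hs0 hs1 (∫⁻ x, F x) (∫⁻ y, G y)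
  have key : (∫⁻ x, F x) ^ (1 - s) * (∫⁻ y, G y) ^ s ≤ ∫⁻ z, K z := amgm.trans core
  simp only [hF_def, hG_def, hK_def] at key
  rw [lintegral_mul_const _ hf, lintegral_mul_const _ hg, lintegral_mul_const _ hh,
    ENNReal.mul_rpow_of_nonneg _ _ h1s.le, ENNReal.mul_rpow_of_nonneg _ _ hs0.le,
    mul_mul_mul_comm, ENNReal.inv_rpow, ENNReal.inv_rpow, hDinv] at key
  exact (ENNReal.mul_le_mul_iff_left (ENNReal.inv_ne_zero.2 hDtop) (ENNReal.inv_ne_top.2 hD0)).1 key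

/-- **Prékopa–Leindler inequality on the line** (`ℝ≥0∞`-valued form): if `f, g, h : ℝ → [0,∞]`
are measurable, `0 < s < 1` and `h((1-s)x + sy) ≥ f(x)^{1-s} g(y)^s` for all `x, y`, then
`∫ h ≥ (∫ f)^{1-s} (∫ g)^s`. (Brascamp–Lieb 1976, Thm 3.2 with `α = 0`, in the classical `sup`
form, which is implied by their `ess sup` form.) [cite: BrascampLieb1976, Thm 3.2] -/
theorem prekopaLeindler_real {s : ℝ} (hs0 : 0 < s) (hs1 : s < 1)
    {f g h : ℝ → ℝ≥0∞} (hf : Measurable f) (hg : Measurable g) (hh : Measurable h)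
    (H : ∀ x y, f x ^ (1 - s) * g y ^ s ≤ h ((1 - s) • x + s • y)) :
    (∫⁻ x, f x) ^ (1 - s) * (∫⁻ y, g y) ^ s ≤ ∫⁻ z, h z := by
  have h1s : 0 < 1 - s := by linarith
  rcases eq_or_ne (∫⁻ x, f x) 0 with hf0 | hf0
  · simp [hf0, ENNReal.zero_rpow_of_pos h1s]
  rcases eq_or_ne (∫⁻ y, g y) 0 with hg0 | hg0
  · simp [hg0, ENNReal.zero_rpow_of_pos hs0]
  set fN : ℕ → ℝ → ℝ≥0∞ := fun N x => min (f x) N with hfN_def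
  set gN : ℕ → ℝ → ℝ≥0∞ := fun N y => min (g y) N with hgN_def
  have hfNm : ∀ N, Measurable (fN N) := fun N => hf.min measurable_const
  have hgNm : ∀ N, Measurable (gN N) := fun N => hg.min measurable_const
  have hN : ∀ N : ℕ, (∫⁻ x, fN N x) ^ (1 - s) * (∫⁻ y, gN N y) ^ s ≤ ∫⁻ z, h z := fun N =>
    prekopaLeindler_real_of_bounded hs0 hs1 (hfNm N) (hgNm N) hh
      (fun x y => le_trans (mul_le_mul' (ENNReal.rpow_le_rpow (min_le_left _ _) h1s.le)
        (ENNReal.rpow_le_rpow (min_le_left _ _) hs0.le)) (H x y))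
      (ENNReal.natCast_ne_top N) (fun x => min_le_right _ _) (fun y => min_le_right _ _)
  have tmin : ∀ a : ℝ≥0∞, Tendsto (fun N : ℕ => min a (N : ℝ≥0∞)) atTop (𝓝 a) := by
    intro a
    have key : Tendsto (fun N : ℕ => min a (N : ℝ≥0∞)) atTop (𝓝 (min a ⊤)) :=
      tendsto_const_nhds.min ENNReal.tendsto_nat_nhds_top
    rwa [min_eq_left le_top] at key
  have tf : Tendsto (fun N => ∫⁻ x, fN N x) atTop (𝓝 (∫⁻ x, f x)) :=
    lintegral_tendsto_of_tendsto_of_monotone (fun N => (hfNm N).aemeasurable)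
      (Eventually.of_forall fun x => fun N M hNM => min_le_min le_rfl (by exact_mod_cast hNM))
      (Eventually.of_forall fun x => tmin (f x))
  have tg : Tendsto (fun N => ∫⁻ y, gN N y) atTop (𝓝 (∫⁻ y, g y)) :=
    lintegral_tendsto_of_tendsto_of_monotone (fun N => (hgNm N).aemeasurable)
      (Eventually.of_forall fun y => fun N M hNM => min_le_min le_rfl (by exact_mod_cast hNM))
      (Eventually.of_forall fun y => tmin (g y))
  have hf0' : (∫⁻ x, f x) ^ (1 - s) ≠ 0 := by simp [ENNReal.rpow_eq_zero_iff, hf0, hs1.le]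
  have hg0' : (∫⁻ y, g y) ^ s ≠ 0 := by simp [ENNReal.rpow_eq_zero_iff, hg0, hs0.le]
  have tprod : Tendsto (fun N => (∫⁻ x, fN N x) ^ (1 - s) * (∫⁻ y, gN N y) ^ s) atTop
      (𝓝 ((∫⁻ x, f x) ^ (1 - s) * (∫⁻ y, g y) ^ s)) :=
    ENNReal.Tendsto.mul ((ENNReal.continuous_rpow_const.tendsto _).comp tf) (Or.inl hf0')
      ((ENNReal.continuous_rpow_const.tendsto _).comp tg) (Or.inl hg0')
  exact le_of_tendsto' tprod hN

/-! ### Prékopa–Leindler in `ℝⁿ` by induction on the dimension (Brascamp–Lieb 1976, Theorem 3.3) -/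

/-- Splitting off the first coordinate is linear:
`c • ins(a₀, x) + d • ins(a₁, y) = ins(c a₀ + d a₁, c x + d y)`. [folklore] -/
private theorem piFinSuccAbove_symm_linear (n : ℕ) (c d a₀ a₁ : ℝ) (x y : Fin n → ℝ) :
    c • (MeasurableEquiv.piFinSuccAbove (fun _ : Fin (n + 1) => ℝ) 0).symm (a₀, x) +
      d • (MeasurableEquiv.piFinSuccAbove (fun _ : Fin (n + 1) => ℝ) 0).symm (a₁, y) =
      (MeasurableEquiv.piFinSuccAbove (fun _ : Fin (n + 1) => ℝ) 0).symm
        (c • a₀ + d • a₁, c • x + d • y) := by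
  ext j
  simp only [MeasurableEquiv.piFinSuccAbove_symm_apply, Pi.add_apply, Pi.smul_apply, smul_eq_mul]
  refine Fin.cases ?_ (fun i => ?_) j
  · simp
  · simp

/-- **Prékopa–Leindler inequality in `ℝⁿ`** (product coordinates, `ℝ≥0∞`-valued form): if
`f, g, h : ℝⁿ → [0,∞]` are measurable, `0 < s < 1` and `h((1-s)x + sy) ≥ f(x)^{1-s} g(y)^s`, then
`∫ h ≥ (∫ f)^{1-s} (∫ g)^s`. Proof by induction on `n` (sections + Tonelli), as in
Brascamp–Lieb 1976, Thm 3.3 (case `α = 0`, classical `sup` form). [cite: BrascampLieb1976, Thm 3.3] -/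
theorem prekopaLeindler_pi {s : ℝ} (hs0 : 0 < s) (hs1 : s < 1) :
    ∀ (n : ℕ) {f g h : (Fin n → ℝ) → ℝ≥0∞}, Measurable f → Measurable g → Measurable h →
      (∀ x y, f x ^ (1 - s) * g y ^ s ≤ h ((1 - s) • x + s • y)) →
      (∫⁻ x, f x) ^ (1 - s) * (∫⁻ y, g y) ^ s ≤ ∫⁻ z, h z := by
  intro n
  induction n with
  | zero =>
    intro f g h hf hg hh H
    set x₀ : Fin 0 → ℝ := fun _ => 0
    rw [Measure.volume_pi_eq_dirac x₀, lintegral_dirac' _ hf, lintegral_dirac' _ hg, lintegral_dirac' _ hh]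
    have := H x₀ x₀
    rwa [Subsingleton.elim ((1 - s) • x₀ + s • x₀) x₀] at this
  | succ n ih =>
    intro f g h hf hg hh H
    set e := MeasurableEquiv.piFinSuccAbove (fun _ : Fin (n + 1) => ℝ) 0 with he_def
    have hemp : MeasurePreserving e := volume_preserving_piFinSuccAbove (fun _ => ℝ) 0
    have hint : ∀ u : (Fin (n + 1) → ℝ) → ℝ≥0∞, Measurable u →
        ∫⁻ x, u x = ∫⁻ a : ℝ, ∫⁻ z : Fin n → ℝ, u (e.symm (a, z)) := by
      intro u hu
      rw [← hemp.symm.lintegral_comp hu, Measure.volume_eq_prod]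
      exact lintegral_prod _ (hu.comp e.symm.measurable).aemeasurable
    have hsec : ∀ u : (Fin (n + 1) → ℝ) → ℝ≥0∞, Measurable u → ∀ a : ℝ,
        Measurable fun z : Fin n → ℝ => u (e.symm (a, z)) :=
      fun u hu a => hu.comp (e.symm.measurable.comp (measurable_const.prodMk measurable_id))
    have hpar : ∀ u : (Fin (n + 1) → ℝ) → ℝ≥0∞, Measurable u →
        Measurable fun a : ℝ => ∫⁻ z : Fin n → ℝ, u (e.symm (a, z)) :=
      fun u hu => (hu.comp e.symm.measurable).lintegral_prod_right'
    -- the induction hypothesis on the sections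
    have hIH : ∀ a₀ a₁ : ℝ,
        (∫⁻ z, f (e.symm (a₀, z))) ^ (1 - s) * (∫⁻ z, g (e.symm (a₁, z))) ^ s ≤
          ∫⁻ z, h (e.symm ((1 - s) • a₀ + s • a₁, z)) := by
      intro a₀ a₁
      refine ih (hsec f hf a₀) (hsec g hg a₁) (hsec h hh _) fun x y => ?_
      rw [he_def, ← piFinSuccAbove_symm_linear n (1 - s) s a₀ a₁ x y]
      exact H _ _
    rw [hint f hf, hint g hg, hint h hh]
    exact prekopaLeindler_real hs0 hs1 (hpar f hf) (hpar g hg) (hpar h hh) hIH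

/-- **Prékopa–Leindler inequality on Euclidean space** `EuclideanSpace ℝ (Fin n)`
(`ℝ≥0∞`-valued form). [cite: BrascampLieb1976, Thm 3.3] -/
theorem prekopaLeindler {n : ℕ} {s : ℝ} (hs0 : 0 < s) (hs1 : s < 1)
    {f g h : EuclideanSpace ℝ (Fin n) → ℝ≥0∞} (hf : Measurable f) (hg : Measurable g)
    (hh : Measurable h) (H : ∀ x y, f x ^ (1 - s) * g y ^ s ≤ h ((1 - s) • x + s • y)) :
    (∫⁻ x, f x) ^ (1 - s) * (∫⁻ y, g y) ^ s ≤ ∫⁻ z, h z := by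
  have hmp := PiLp.volume_preserving_toLp (Fin n)
  rw [← hmp.lintegral_comp hf, ← hmp.lintegral_comp hg, ← hmp.lintegral_comp hh]
  refine prekopaLeindler_pi hs0 hs1 n (hf.comp hmp.measurable) (hg.comp hmp.measurable)
    (hh.comp hmp.measurable) fun x y => ?_
  simp only [WithLp.toLp_add, WithLp.toLp_smul]
  exact H _ _

/-- **Prékopa–Leindler inequality**, real-valued form on `EuclideanSpace ℝ (Fin n)`: for
measurable nonnegative `f, g` and integrable nonnegative `h` with
`h((1-s)x + sy) ≥ f(x)^{1-s} g(y)^s` (`0 < s < 1`), `(∫ f)^{1-s} (∫ g)^s ≤ ∫ h`.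
[cite: BrascampLieb1976, Thm 3.3] -/
theorem prekopaLeindler_integral {n : ℕ} {s : ℝ} (hs0 : 0 < s) (hs1 : s < 1)
    {f g h : EuclideanSpace ℝ (Fin n) → ℝ} (hf : Measurable f) (hg : Measurable g)
    (hh : Measurable h) (hf0 : ∀ x, 0 ≤ f x) (hg0 : ∀ x, 0 ≤ g x) (hh0 : ∀ x, 0 ≤ h x)
    (hfi : Integrable f) (hgi : Integrable g) (hhi : Integrable h)
    (H : ∀ x y, f x ^ (1 - s) * g y ^ s ≤ h ((1 - s) • x + s • y)) :
    (∫ x, f x) ^ (1 - s) * (∫ y, g y) ^ s ≤ ∫ z, h z := by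
  have h1s : 0 ≤ 1 - s := by linarith
  have key := prekopaLeindler hs0 hs1 hf.ennreal_ofReal hg.ennreal_ofReal hh.ennreal_ofReal
    (fun x y => by
      rw [ENNReal.ofReal_rpow_of_nonneg (hf0 x) h1s, ENNReal.ofReal_rpow_of_nonneg (hg0 y) hs0.le,
        ← ENNReal.ofReal_mul (Real.rpow_nonneg (hf0 x) _)]
      exact ENNReal.ofReal_le_ofReal (H x y))
  rw [← ofReal_integral_eq_lintegral_ofReal hfi (Eventually.of_forall hf0),
    ← ofReal_integral_eq_lintegral_ofReal hgi (Eventually.of_forall hg0),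
    ← ofReal_integral_eq_lintegral_ofReal hhi (Eventually.of_forall hh0),
    ENNReal.ofReal_rpow_of_nonneg (integral_nonneg hf0) h1s,
    ENNReal.ofReal_rpow_of_nonneg (integral_nonneg hg0) hs0.le,
    ← ENNReal.ofReal_mul (Real.rpow_nonneg (integral_nonneg hf0) _)] at key
  exact (ENNReal.ofReal_le_ofReal_iff (integral_nonneg hh0)).1 key

end Literature.Analysis.Convexity
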